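import Literature.MathematicalPhysics.QuantumFieldTheory.Balaban1983to89.B1Eq211ZeroFieldTorus
import Literature.MathematicalPhysics.QuantumFieldTheory.Balaban1983to89.B2Ineq329ZeroAveraging

/-!
# `Balaban1983to89.B1Eq211ZeroFieldTorusLevels` — T. Bałaban, *(Higgs)₂,₃ quantum fields in a finite volume. I. A lower bound*,
# Commun. Math. Phys. **85** (1982) 603–626 [Balaban1982Higgs1]: gen 8's zero-field bridge `B1Eq211ZeroFieldTorus` (ONE lattice, TWO
# formalizations) ONE LEVEL DOWN — the (Higgs)₂,₃ tori (1.2) of the sub-family `M·L′_μ = L^m` identified with `Setup`'s tori whose TOP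
# level is an arbitrary `k ≦ K` (so that `T^{(k)}_{L^kε}` is the unit lattice of (2.22)), for `ℝ^N`-valued fields and EVERY coupling
# `U = exp(qεeA)` at `A = 0`

statement-level skeleton of published theorems with citation tags; proofs where landed; nothing here is a claim about the Yang–Mills mass gap

PDF held: `paper:balaban1982-cmp85-higgs23-i` (journal page = PDF page + 602); p. 604 [PDF 2] ((1.2)–(1.5)), p. 605 [PDF 3] ((1.7)),
p. 606–607 [PDF 4–5] ((1.17)–(1.20)), p. 608–610 [PDF 6–8] ((2.2), (2.3), (2.11), (2.17), (2.20), (2.22)); ×2 renders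
`run/shared/lean/pub/pub-balaban/b2b-balaban-ref1/pages/1982-cmp85-higgs23-I/1982-cmp85-higgs23-I-p002…p008-x2.png`.

CITATION HEADER (lean-in-tree rule).  Cell `lit-balaban` (HOME `run/shared/lean/pub/lit-balaban/`), Phase-2 proof seat **p14** gen 9
(unit `lit-balaban-p14`); KNITTING for SKELETON rows **B1.Eq1.2**, **B1.Eq2.2**, **B1.Eq2.10–2.11**, **B1.Eq2.17**, **B1.Eq2.20** (r14/r01);
file 1 of three (`B1Eq220ZeroFieldTorusLevels`: the level-`k` dictionaries and `G^ε_k(T_ε,0) = (L^kε)²·G_k`; `B1Ineq225ZeroFieldTorusLevels`: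
the estimates (2.25) / [B4] Cor. 2.3 at every level).  USED BY NAME, never restated: gen 8's `B1Eq211ZeroFieldTorus.Shape` (whose §1–§2
this file repeats with top level `k` instead of `K` — `Shape.toSetup` is `setupAt S K` up to `m + 0 = m`); the typer's `HiggsLattice`,
`HiggsAveraging`, `HiggsCovariance`; `B3MultiscaleFields.zeroCharge`; pv07/p38's `Setup`, `Site.proj`, `B1RG242Torus`.

WHAT IS PRINTED (verbatim).  p. 604 [PDF 2], (1.2): *"T_ε = {x ∈ εZ^d : −L_μ ≦ x_μ < L_μ, μ = 1, …, d}, where ε^{−1}L_μ = L^K M L′_μ"*;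
p. 605 [PDF 3]: *"U(A) = exp(qεeA), A ∈ R, where e is a coupling constant and q is an antisymmetric N × N matrix"*; p. 608 [PDF 6]:
*"Let us denote by x_j a point of torus T^{(j)}_{L^jε}, such that x ∈ B^j(x_j)"*; p. 609 [PDF 7], (2.11): *"(Q_k(A)f)(y) =
L^{−kd}Σ_{x∈B^k(y)} U(A(Γ^{(k)}_{y,x}))f(x)"*; p. 610 [PDF 8], (2.20): *"G^ε_k(Ω,A) = (−Δ^{ε,N}_{A,Ω} + m² + a_k(L^kε)^{−2}P_k(A))^{−1},
P_k(A) = Q^*_k(A)Q_k(A)"*; (2.22): *"This operator can be treated as defined on the unit lattice because L^kη = 1"*.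

WHAT THIS FILE PROVES (kernel-checked, zero `sorry`; the new `def`s are transports/reindexings only — `setupAt`, `eSiteAt`, `cmpAt`,
`liftAt`; no `def … : Prop`, no new named fact; axioms standard).
* §1 `setupAt S k = (d, L, m + (K − k), k)`; `sitesPerDir_eq_at` (`2L^{K−j}ML′_μ = 2L^{(m+K−k)+k−j}`, `j ≦ k ≦ K`); `mesh_zero_eq_at`
  (`ε = (L^kε)·L^{−k}`); `spacing_top` (level `k` is `setupAt`'s unit lattice); `eSiteAt : T^{(j)}_{L^jε} ≃ Site (setupAt S k) j`,
  `val_eSiteAt`, `eSiteAt_shift/unshift`, `eSiteAt_blockOf` ((1.17)), `eSiteAt_blockIter` (`x_j` of (2.2) = `Site.proj j j`),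
  `sum_blockK_eq_at` (the block sums of (2.11)).
* §2 `cmpAt` (the `i`-th component read on the level-`k` torus), `eq_of_cmpAt_eq`, `liftAt` (a torus matrix acting on every component),
  `cmpAt_liftAt`.
* §3 **AT ZERO FIELD THE COUPLING IS INVISIBLE** (`A(Γ) = 0`, p15's `B2Ineq329ZeroAveraging.multiContourSum_zero_field`; `U(0) = 1`):
  `covLaplacianN_charge_zeroField`,
  `avgQkLin_charge_zeroField`, `avgQkAdj_charge_zeroField`, `projPk_charge_zeroField`, `covOpK_charge_zeroField`,
  `propagatorK_charge_zeroField` — for every `ChargeData C` the operators (2.17), (2.11), (2.20) at `A = 0` are those of `zeroCharge N`.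
HONEST SCOPE: bookkeeping only (nothing quantitative); zero external field; whole torus; the sub-family `M·L′_μ = L^m`, `L` odd; `j ≦ k ≦ K`.
Unit `lit-balaban-p14` gen 9 (literature-prover-lit-balaban-p14-g9-0).
-/

open scoped BigOperators
open Matrix

namespace Literature.MathematicalPhysics.QuantumFieldTheory.Balaban1983to89.B1Eq211ZeroFieldTorusLevels

open Literature.MathematicalPhysics.QuantumFieldTheory.Balaban1983to89.HiggsLattice (ChargeData)
open Literature.MathematicalPhysics.QuantumFieldTheory.Balaban1983to89.HiggsAveraging (blockIter blockK mem_blockK)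
open Literature.MathematicalPhysics.QuantumFieldTheory.Balaban1983to89.B2Ineq329ZeroAveraging (multiContourSum_zero_field)
open Literature.MathematicalPhysics.QuantumFieldTheory.Balaban1983to89.HiggsCovariance (covLaplacianN fwdTerm bwdTerm avgQkLin avgQkAdj
  projPk covOpK propagatorK)
open Literature.MathematicalPhysics.QuantumFieldTheory.Balaban1983to89.B3MultiscaleFields (zeroCharge)
open Literature.MathematicalPhysics.QuantumFieldTheory.Balaban1983to89.B1RG242Torus (lvl_of_le sitesPerDir_zero_eq sitesPerDir_eq_succ
  stepExp_of_lt)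
open Literature.MathematicalPhysics.QuantumFieldTheory.Balaban1983to89.B1Eq211ZeroFieldTorus (Shape)

variable {P : HiggsLattice.Params}

/-! ## §1 The level-`k` `Setup` torus of a shape: top level `k`, volume exponent `m + (K − k)` -/

/-- **The `Setup` parameters `(d, L, m + (K − k), k)` of a torus of the sub-family seen with TOP LEVEL `k`**: the same site counts
`2L^{m+K−j}` at every level `j ≦ k` (`sitesPerDir_eq_at`), but the unit lattice of `Setup` is now `T^{(k)}_{L^kε}` — the rescaling (2.22)
at level `k` (*"This operator can be treated as defined on the unit lattice because L^kη = 1"*). [cite: Balaban1982Higgs1, (2.22) p.610] -/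
def setupAt (S : Shape P) (k : ℕ) : Params := ⟨P.d, P.L, S.m + (P.K - k), k, P.hd, S.hL⟩

section SetupAt

variable (S : Shape P) {k : ℕ}

/-- `d` is the model's `d` ((1.2)). [cite: Balaban1982Higgs1, (1.2) p.604] -/
@[simp] theorem setupAt_d (k : ℕ) : (setupAt S k).d = P.d := rfl

/-- `L` is the model's `L` ((1.2)). [cite: Balaban1982Higgs1, (1.2) p.604] -/
@[simp] theorem setupAt_L (k : ℕ) : (setupAt S k).L = P.L := rfl

/-- The top level of `setupAt S k` is `k` ((2.22): the unit lattice is `T^{(k)}`). [cite: Balaban1982Higgs1, (2.22) p.610] -/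
@[simp] theorem setupAt_K (k : ℕ) : (setupAt S k).K = k := rfl

/-- The volume exponent of `setupAt S k` is `m + (K − k)`. [cite: Balaban1982Higgs1, (1.2) p.604] -/
theorem setupAt_m (k : ℕ) : (setupAt S k).m = S.m + (P.K - k) := rfl

/-- **The site counts agree at every level `j ≦ k ≦ K`**: `2L^{K−j}ML′_μ = 2L^{(m+K−k)+k−j}` ((1.2)/(1.20) versus B12 (0.1)).
[cite: Balaban1982Higgs1, (1.20) p.607] -/
theorem sitesPerDir_eq_at (hk : k ≤ P.K) {j : ℕ} (hj : j ≤ k) (μ : Fin P.d) :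
    P.sitesPerDir j μ = (setupAt S k).sitesPerDir j := by
  show 2 * (P.L ^ (P.K - j) * P.M * P.Lp μ) = 2 * P.L ^ (S.m + (P.K - k) + k - j)
  rw [mul_assoc (P.L ^ (P.K - j)), S.hM μ, ← pow_add]
  have h : P.K - j + S.m = S.m + (P.K - k) + k - j := by omega
  rw [h]

/-- `setupAt`'s fine spacing is `L^{−k}`; the model's is `ε = (L^kε)·L^{−k}`. [cite: Balaban1982Higgs1, (1.19) p.607] -/
theorem mesh_zero_eq_at (k : ℕ) : P.mesh 0 = P.mesh k * (setupAt S k).eps := by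
  show (P.L : ℝ) ^ 0 * P.ε = (P.L : ℝ) ^ k * P.ε * (((P.L : ℝ)⁻¹) ^ k)
  have hL : (P.L : ℝ) ≠ 0 := by
    have := S.hL.2
    exact_mod_cast (show P.L ≠ 0 by omega)
  rw [pow_zero, one_mul, inv_pow, mul_comm ((P.L : ℝ) ^ k) P.ε, mul_assoc, mul_inv_cancel₀ (pow_ne_zero _ hL), mul_one]

/-- Level `k` of `setupAt S k` is the unit lattice: `L^k·L^{−k} = 1` ((2.22), `L^kη = 1`). [cite: Balaban1982Higgs1, (2.22) p.610] -/
theorem spacing_top (k : ℕ) : (setupAt S k).spacing k = 1 := (setupAt S k).spacing_K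

/-- Every level `j ≦ k` is in `setupAt`'s standing range `j ≦ m_S + K_S`. [cite: Balaban1982Higgs1, (1.20) p.607] -/
theorem le_range_at (k : ℕ) {j : ℕ} (hj : j ≤ k) : j ≤ (setupAt S k).m + (setupAt S k).K :=
  hj.trans (Nat.le_add_left _ _)

end SetupAt

/-- **THE CARRIER IDENTIFICATION `T^{(j)}_{L^jε} ≃ T^{(j)}` of the level-`k` torus** (`j ≦ k ≦ K`): coordinatewise
`ZMod.ringEquivCongr` along `sitesPerDir_eq_at`. [cite: Balaban1982Higgs1, (1.2) p.604] -/
def eSiteAt (S : Shape P) {k : ℕ} (hk : k ≤ P.K) {j : ℕ} (hj : j ≤ k) : HiggsLattice.Site P j ≃ Site (setupAt S k) j where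
  toFun x := fun μ => ZMod.ringEquivCongr (sitesPerDir_eq_at S hk hj μ) (x μ)
  invFun z := fun μ => (ZMod.ringEquivCongr (sitesPerDir_eq_at S hk hj μ)).symm (z μ)
  left_inv x := funext fun μ => (ZMod.ringEquivCongr (sitesPerDir_eq_at S hk hj μ)).symm_apply_apply (x μ)
  right_inv z := funext fun μ => (ZMod.ringEquivCongr (sitesPerDir_eq_at S hk hj μ)).apply_symm_apply (z μ)

section Carrier

variable (S : Shape P) {k : ℕ} (hk : k ≤ P.K)

/-- Unfolding of `eSiteAt` (the tori (1.2)). [cite: Balaban1982Higgs1, (1.2) p.604] -/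
theorem eSiteAt_apply {j : ℕ} (hj : j ≤ k) (x : HiggsLattice.Site P j) (μ : Fin P.d) :
    eSiteAt S hk hj x μ = ZMod.ringEquivCongr (sitesPerDir_eq_at S hk hj μ) (x μ) := rfl

/-- The identification preserves the integer labels of (1.2). [cite: Balaban1982Higgs1, (1.2) p.604] -/
theorem val_eSiteAt {j : ℕ} (hj : j ≤ k) (x : HiggsLattice.Site P j) (μ : Fin P.d) :
    ((eSiteAt S hk hj x) μ).val = (x μ).val := by
  rw [eSiteAt_apply]
  exact ZMod.ringEquivCongr_val _ _

/-- Unit steps forward correspond: `e(x + L^jεe_μ) = e(x) + e_μ`. [cite: Balaban1982Higgs1, (1.2) p.604] -/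
theorem eSiteAt_shift {j : ℕ} (hj : j ≤ k) (x : HiggsLattice.Site P j) (μ : Fin P.d) :
    eSiteAt S hk hj (x.shift μ) = (eSiteAt S hk hj x).shift μ := by
  funext ν
  by_cases h : ν = μ
  · subst h
    simp only [eSiteAt_apply, HiggsLattice.Site.shift, Site.shift, Function.update_self, map_add, map_one]
  · have hx : Function.update x μ (x μ + 1) ν = x ν := Function.update_of_ne h _ _
    simp only [eSiteAt_apply, HiggsLattice.Site.shift, Site.shift, hx, Function.update_of_ne h]

/-- Unit steps backward correspond: `e(x − L^jεe_μ) = e(x) − e_μ`. [cite: Balaban1982Higgs1, (1.2) p.604] -/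
theorem eSiteAt_unshift {j : ℕ} (hj : j ≤ k) (x : HiggsLattice.Site P j) (μ : Fin P.d) :
    eSiteAt S hk hj (x.unshift μ) = (eSiteAt S hk hj x).unshift μ := by
  funext ν
  by_cases h : ν = μ
  · subst h
    simp only [eSiteAt_apply, HiggsLattice.Site.unshift, Site.unshift, Function.update_self, map_sub, map_one]
  · have hx : Function.update x μ (x μ - 1) ν = x ν := Function.update_of_ne h _ _
    simp only [eSiteAt_apply, HiggsLattice.Site.unshift, Site.unshift, hx, Function.update_of_ne h]

/-- The inverse identification and forward steps on `T_ε` (1.2). [cite: Balaban1982Higgs1, (1.2) p.604] -/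
theorem eSiteAt_symm_shift {j : ℕ} (hj : j ≤ k) (z : Site (setupAt S k) j) (μ : Fin P.d) :
    (eSiteAt S hk hj).symm (z.shift μ) = ((eSiteAt S hk hj).symm z).shift μ := by
  rw [Equiv.symm_apply_eq, eSiteAt_shift, Equiv.apply_symm_apply]

/-- The inverse identification and backward steps on `T_ε` (1.2). [cite: Balaban1982Higgs1, (1.2) p.604] -/
theorem eSiteAt_symm_unshift {j : ℕ} (hj : j ≤ k) (z : Site (setupAt S k) j) (μ : Fin P.d) :
    (eSiteAt S hk hj).symm (z.unshift μ) = ((eSiteAt S hk hj).symm z).unshift μ := by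
  rw [Equiv.symm_apply_eq, eSiteAt_unshift, Equiv.apply_symm_apply]

/-- **Blocks correspond** ((1.17), in labels: `y = ⌊x/L⌋` coordinatewise, both vocabularies), `j + 1 ≦ k`.
[cite: Balaban1982Higgs1, (1.17) p.606] -/
theorem eSiteAt_blockOf {j : ℕ} (hj : j + 1 ≤ k) (x : HiggsLattice.Site P j) :
    eSiteAt S hk hj (HiggsLattice.blockOf x) = blockOf (eSiteAt S hk (Nat.le_of_succ_le hj) x) := by
  funext μ
  rw [eSiteAt_apply]
  show ZMod.ringEquivCongr _ ((((x μ).val / P.L : ℕ)) : ZMod (P.sitesPerDir (j + 1) μ))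
    = ((((eSiteAt S hk (Nat.le_of_succ_le hj) x) μ).val / (setupAt S k).L : ℕ) : ZMod ((setupAt S k).sitesPerDir (j + 1)))
  rw [map_natCast, val_eSiteAt]
  rfl

/-- **The `j`-fold block point `x_j` of (2.2) is `setupAt`'s `Site.proj j j`** (`x ∈ B^j(x_j)`), `j ≦ k`.
[cite: Balaban1982Higgs1, (2.2) p.608] -/
theorem eSiteAt_blockIter {j : ℕ} (hj : j ≤ k) (x : HiggsLattice.Site P 0) :
    eSiteAt S hk hj (blockIter j x) = Site.proj j j (eSiteAt S hk (Nat.zero_le _) x) := by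
  induction j with
  | zero =>
      rw [Site.proj_zero]
      rfl
  | succ j ih =>
      have hj' : j ≤ k := Nat.le_of_succ_le hj
      have hkm : j ≤ (setupAt S k).m + (setupAt S k).K := le_range_at S k hj'
      have hkm1 : j + 1 ≤ (setupAt S k).m + (setupAt S k).K := le_range_at S k hj
      have h0 : (setupAt S k).sitesPerDir 0 = (setupAt S k).L ^ j * (setupAt S k).sitesPerDir j := by
        rw [sitesPerDir_zero_eq (setupAt S k) j, lvl_of_le (setupAt S k) hkm]
      have h1 : (setupAt S k).sitesPerDir j = (setupAt S k).L ^ 1 * (setupAt S k).sitesPerDir (j + 1) := by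
        rw [sitesPerDir_eq_succ (setupAt S k) j, stepExp_of_lt (setupAt S k) hkm1]
      show eSiteAt S hk hj (HiggsLattice.blockOf (blockIter j x)) = _
      rw [eSiteAt_blockOf S hk hj, ih hj', ← Site.proj_one_eq_blockOf, Site.proj_comp h0 h1]

/-- Membership in the `j`-fold block read through the identification. [cite: Balaban1982Higgs1, (1.20) p.607] -/
theorem blockIter_eq_iff_at {j : ℕ} (hj : j ≤ k) (x : HiggsLattice.Site P 0) (y : HiggsLattice.Site P j) :
    blockIter j x = y ↔ Site.proj j j (eSiteAt S hk (Nat.zero_le _) x) = eSiteAt S hk hj y := by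
  rw [← eSiteAt_blockIter S hk hj, (eSiteAt S hk hj).apply_eq_iff_eq]

/-- **Sums over the `j`-fold block `B^j(y)` correspond** (the sums in (2.11)), `j ≦ k`. [cite: Balaban1982Higgs1, (2.11) p.609] -/
theorem sum_blockK_eq_at {M : Type*} [AddCommMonoid M] {j : ℕ} (hj : j ≤ k) (y : HiggsLattice.Site P j)
    (F : HiggsLattice.Site P 0 → M) :
    ∑ x ∈ blockK j y, F x
      = ∑ z ∈ Finset.univ.filter (fun z : Site (setupAt S k) 0 => Site.proj j j z = eSiteAt S hk hj y),
          F ((eSiteAt S hk (Nat.zero_le _)).symm z) := by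
  refine Finset.sum_equiv (eSiteAt S hk (Nat.zero_le _)) (fun x => ?_) (fun x _ => by rw [Equiv.symm_apply_apply])
  simp only [mem_blockK, Finset.mem_filter, Finset.mem_univ, true_and, blockIter_eq_iff_at S hk hj]

end Carrier

/-! ## §2 Components of an `ℝ^N`-valued field on the level-`k` torus; transport of a torus matrix -/

section Components

variable (S : Shape P) {k : ℕ} (hk : k ≤ P.K) {N : ℕ}

/-- **The `i`-th component of a field on `T_ε`, read on the level-`k` `Setup` torus**: `(cmp_i φ)(z) = φ(e⁻¹z)_i` (linear).
[cite: Balaban1982Higgs1, (1.5) p.604] -/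
def cmpAt (i : Fin N) : HiggsLattice.ScalarField P 0 N →ₗ[ℝ] (Site (setupAt S k) 0 → ℝ) where
  toFun φ := fun z => φ ((eSiteAt S hk (Nat.zero_le _)).symm z) i
  map_add' φ ψ := by
    funext z
    simp only [Pi.add_apply, PiLp.add_apply]
  map_smul' c φ := by
    funext z
    simp only [Pi.smul_apply, PiLp.smul_apply, smul_eq_mul, RingHom.id_apply]

/-- Unfolding of `cmpAt` (fields on `T_ε`, (1.5)). [cite: Balaban1982Higgs1, (1.5) p.604] -/
@[simp] theorem cmpAt_apply (i : Fin N) (φ : HiggsLattice.ScalarField P 0 N) (z : Site (setupAt S k) 0) :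
    cmpAt S hk i φ z = φ ((eSiteAt S hk (Nat.zero_le _)).symm z) i := rfl

/-- `cmpAt` at an identified site ((1.5)). [cite: Balaban1982Higgs1, (1.5) p.604] -/
theorem cmpAt_apply_eSiteAt (i : Fin N) (φ : HiggsLattice.ScalarField P 0 N) (x : HiggsLattice.Site P 0) :
    cmpAt S hk i φ (eSiteAt S hk (Nat.zero_le _) x) = φ x i := by
  rw [cmpAt_apply, Equiv.symm_apply_apply]

/-- `cmpAt` and forward steps ((1.2), (1.5)). [cite: Balaban1982Higgs1, (1.5) p.604] -/
theorem cmpAt_shift (i : Fin N) (φ : HiggsLattice.ScalarField P 0 N) (x : HiggsLattice.Site P 0) (μ : Fin P.d) :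
    cmpAt S hk i φ ((eSiteAt S hk (Nat.zero_le _) x).shift μ) = φ (x.shift μ) i := by
  rw [cmpAt_apply, eSiteAt_symm_shift, Equiv.symm_apply_apply]

/-- `cmpAt` and backward steps ((1.2), (1.5)). [cite: Balaban1982Higgs1, (1.5) p.604] -/
theorem cmpAt_unshift (i : Fin N) (φ : HiggsLattice.ScalarField P 0 N) (x : HiggsLattice.Site P 0) (μ : Fin P.d) :
    cmpAt S hk i φ ((eSiteAt S hk (Nat.zero_le _) x).unshift μ) = φ (x.unshift μ) i := by
  rw [cmpAt_apply, eSiteAt_symm_unshift, Equiv.symm_apply_apply]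

/-- A field on `T_ε` ((1.5)) is determined by its components on the level-`k` torus. [cite: Balaban1982Higgs1, (1.5) p.604] -/
theorem eq_of_cmpAt_eq {φ ψ : HiggsLattice.ScalarField P 0 N} (h : ∀ i, cmpAt S hk i φ = cmpAt S hk i ψ) : φ = ψ := by
  funext x
  refine PiLp.ext fun i => ?_
  have := congrFun (h i) (eSiteAt S hk (Nat.zero_le _) x)
  rwa [cmpAt_apply_eSiteAt, cmpAt_apply_eSiteAt] at this

/-- **The transport of a matrix on the level-`k` torus to an operator on the model's `ℝ^N`-valued fields**, acting on each component:
`(lift G φ)(x)_i = (G cmp_iφ)(e x)` (p. 608: *"taking N = d and an external vector field A = 0"* — `N` copies of the scalar case).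
[cite: Balaban1982Higgs1, (2.20) p.610] -/
noncomputable def liftAt (G : Matrix (Site (setupAt S k) 0) (Site (setupAt S k) 0) ℝ) :
    Module.End ℝ (HiggsLattice.ScalarField P 0 N) where
  toFun φ := fun x => WithLp.toLp 2 fun i => (G *ᵥ cmpAt S hk i φ) (eSiteAt S hk (Nat.zero_le _) x)
  map_add' φ ψ := by
    funext x
    refine PiLp.ext fun i => ?_
    simp only [map_add, Matrix.mulVec_add, Pi.add_apply, PiLp.add_apply]
  map_smul' c φ := by
    funext x
    refine PiLp.ext fun i => ?_
    simp only [map_smul, Matrix.mulVec_smul, Pi.smul_apply, PiLp.smul_apply, smul_eq_mul, RingHom.id_apply]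

/-- Unfolding of `liftAt`. [cite: Balaban1982Higgs1, (2.20) p.610] -/
theorem liftAt_apply (G : Matrix (Site (setupAt S k) 0) (Site (setupAt S k) 0) ℝ) (φ : HiggsLattice.ScalarField P 0 N)
    (x : HiggsLattice.Site P 0) (i : Fin N) :
    liftAt S hk G φ x i = (G *ᵥ cmpAt S hk i φ) (eSiteAt S hk (Nat.zero_le _) x) := rfl

/-- The components of the transported operator are the matrix applied to the components. [cite: Balaban1982Higgs1, (2.20) p.610] -/
theorem cmpAt_liftAt (G : Matrix (Site (setupAt S k) 0) (Site (setupAt S k) 0) ℝ) (φ : HiggsLattice.ScalarField P 0 N)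
    (i : Fin N) : cmpAt S hk i (liftAt S hk G φ) = G *ᵥ cmpAt S hk i φ := by
  funext z
  rw [cmpAt_apply, liftAt_apply, Equiv.apply_symm_apply]

end Components

/-! ## §3 At zero field the coupling is invisible: `U(A(Γ)) = U(0) = 1` for every `ChargeData` -/

section ZeroField

variable {N : ℕ} (C : ChargeData N)

/-- **(2.17) at `A = 0` does not see the coupling**: `−Δ^{η,N}_{0,Ω}` for `U = exp(qηeA)` is the one for the trivial coupling
(`U(0) = 1`, p. 605). [cite: Balaban1982Higgs1, (2.17) p.610; (1.7) p.605] -/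
theorem covLaplacianN_charge_zeroField {j : ℕ} (Ω : Finset (HiggsLattice.Site P j)) :
    covLaplacianN C Ω (0 : HiggsLattice.VecField P j) = covLaplacianN (zeroCharge N) Ω 0 := by
  simp only [covLaplacianN, fwdTerm, bwdTerm, Pi.zero_apply, ChargeData.U_zero]

/-- **(2.11) at `A = 0` does not see the coupling**: `Q_k(0)` is the plain block average for every `U`. [cite: Balaban1982Higgs1, (2.11) p.609] -/
theorem avgQkLin_charge_zeroField (k : ℕ) :
    avgQkLin C (0 : HiggsLattice.VecField P 0) k = avgQkLin (zeroCharge N) 0 k := by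
  simp only [avgQkLin, multiContourSum_zero_field, ChargeData.U_zero]

/-- `Q_k^*(0)` does not see the coupling. [cite: Balaban1982Higgs1, (2.20) p.610] -/
theorem avgQkAdj_charge_zeroField (k : ℕ) :
    avgQkAdj C (0 : HiggsLattice.VecField P 0) k = avgQkAdj (zeroCharge N) 0 k := by
  simp only [avgQkAdj, multiContourSum_zero_field, ChargeData.U_zero]

/-- `P_k(0) = Q_k^*(0)Q_k(0)` does not see the coupling. [cite: Balaban1982Higgs1, (2.20) p.610] -/
theorem projPk_charge_zeroField (k : ℕ) :
    projPk C (0 : HiggsLattice.VecField P 0) k = projPk (zeroCharge N) 0 k := by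
  rw [projPk, projPk, avgQkLin_charge_zeroField, avgQkAdj_charge_zeroField]

/-- The operator of (2.20) at `A = 0` does not see the coupling. [cite: Balaban1982Higgs1, (2.20) p.610] -/
theorem covOpK_charge_zeroField (Ω : Finset (HiggsLattice.Site P 0)) (msq a : ℝ) (k : ℕ) :
    covOpK C Ω (0 : HiggsLattice.VecField P 0) msq a k = covOpK (zeroCharge N) Ω 0 msq a k := by
  rw [covOpK, covOpK, covLaplacianN_charge_zeroField, projPk_charge_zeroField]

/-- **The propagator (2.20) at `A = 0` does not see the coupling**: `G^ε_k(Ω, 0)` is the same operator for every `U = exp(qεeA)`.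
[cite: Balaban1982Higgs1, (2.20) p.610] -/
theorem propagatorK_charge_zeroField (Ω : Finset (HiggsLattice.Site P 0)) (msq a : ℝ) (k : ℕ) :
    propagatorK C Ω (0 : HiggsLattice.VecField P 0) msq a k = propagatorK (zeroCharge N) Ω 0 msq a k := by
  rw [propagatorK, propagatorK, covOpK_charge_zeroField]

end ZeroField

end Literature.MathematicalPhysics.QuantumFieldTheory.Balaban1983to89.B1Eq211ZeroFieldTorusLevels
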